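import Summits.KontsevichZagierPeriods.KontsevichZagierPeriods.Theorems.LiouvilleUnfoldingAyoubPiLocalKernel
import Summits.KontsevichZagierPeriods.KontsevichZagierPeriods.Theorems.LiouvilleUnfoldingAyoubPiLocalKernelRing
import Summits.KontsevichZagierPeriods.KontsevichZagierPeriods.Theorems.TerasomaMultiplicationBetaCancellationOfAyoubPiCancellation
import Literature.NumberTheory.Transcendental.KZSubcalculusInvariants
import Literature.NumberTheory.Transcendental.KZCalculusProofs
import Literature.NumberTheory.Transcendental.KZKernelConjectureForms

/-!
# Disproof work file — crux stmt-KontsevichZagierPeriods-0541 `AyoubPiLocalKernel`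

Standing adversary (cdisprove seat `refuter-cdisprove-stmt-KontsevichZagierPeriods-0541-0`) on
`Summit.KontsevichZagierPeriods.KontsevichZagierPeriods.Theses.LiouvilleUnfolding.AyoubPiLocalKernel`
(route LiouvilleUnfolding, rank 6; shared with AyoubSpecialisation r3, AttractorUnfolding,
HurwitzMicroSectors, DefinableMoves):

  `∀ P, IsPinned P → ∀ c : KZ.FormalRep, KZ.eval c = 0 → ∃ N, (lift (of ∘ P))^[N] c ∈ KZ.relations`

where `IsPinned P` pins `P n r = [unit disc] × r` (disc in the two leading coordinates). The item is,
kernel-checked in the tree, EXACTLY `KZ.PiLocalKernel` = J. Ayoub's Conjecture 7 (EMS Newsl. 91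
(2014), Def. 6 / Conj. 7: `Ev : P^eff_KZ[(2πi)⁻¹] → ℂ` injective) transcribed to the four-move
calculus of `KZCalculus.lean` (`PiLocalKernelPosition.ayoubPiLocalKernel_iff_piLocalKernel`, p135819),
and it is implied by the summit with exponent `N = 0` (`ayoubPiLocalKernel_of_summit`).

## Findings (index) — cycle 1

* §0 VOCABULARY. `IsPinned`, `liftP P := lift (of ∘ P)`; `ayoubPiLocalKernel_iff` (`Iff.rfl`);
  `isPinned_unique` — the pinned family is UNIQUE (the non-data fields of `IntegralRep` are proofs),
  so `∀ P, IsPinned P → …` quantifies over exactly one object and `exists_pinned` inhabits it: the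
  interface is neither vacuous nor loose.
* §1 SOUNDNESS SIDE / TIGHTNESS (`eval_liftP`, `eval_liftP_iterate`,
  `eval_eq_zero_of_liftP_iterate_mem`): `eval ((liftP P)^[N] c) = π ^ N · eval c`, hence the
  conclusion of the crux IMPLIES its hypothesis `eval c = 0`; the crux is the equivalence
  `ayoubPiLocalKernel_iff_forall_iff` (`eval c = 0 ↔ ∃ N, …`), i.e. nothing weaker than
  `eval c = 0` can be asked and nothing stronger can be concluded from it.
* §2 LOAD-BEARING `eval c = 0` (`ayoubPiLocalKernel_false_without_evalZero`): dropped, the statement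
  is FALSE — witness `c = [π]` itself (any `c` of non-zero value): no power of the disc turns it into
  a relation, by soundness of the four moves and `π ≠ 0`.
* §3 LOAD-BEARING PINNING (`IsPinned`): dropped (any family `P : ∀ n, IntegralRep n →
  IntegralRep (n+2)` allowed), the statement becomes LITERALLY THE SUMMIT's kernel form
  (`anyFamily_iff_kzKernelConjecture`; witness family `P n r := (r.slab 0).slab 0`, two Newton–Leibniz
  moves away from `r`, so `liftP P ≡ id` modulo relations); hence no `_false_without_pinning` theorem
  exists short of disproving Conjecture 1, and the ONLY thing that can make 0541 weaker than the summit
  is the specific multiplier `[π]`. Same conclusion for pinning at any representation EQUIVALENT TO AN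
  INTEGER `m ≠ 0` (`localKernelAt_intRep_iff_kzKernelConjecture`: `m`-power torsion is no torsion, by
  unique divisibility of the formal period group, `MzvKernelInKZ.Negative.mem_relations_of_nsmul_mem`).
* §4 THE CONSTANT `KZ.relations` — which moves a `[π]`-local certificate needs (natural
  strengthenings to sub-calculi, REFUTED by explicit witnesses):
  (a) without the additivity moves (1a)+(1b): FALSE (`not_piLocalKernel_covNL`; witness `c = [pt, 0]`,
      invariant `KZ.coeffSum`, which `liftP P` preserves);
  (b) without Newton–Leibniz (3): FALSE (`not_piLocalKernel_noNL`; witness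
      `c = [[0,1], 1] − [pt, 1]` — ONE printed rule-(3) move, so in the full calculus the crux's
      conclusion holds for it with `N = 0` — invariant: the dimension-graded evaluation `evalDim k`,
      preserved by (1a), (1b), (2) and shifted by `2` under `liftP P`);
  (c) without change of variables (2): UNDECIDED here — no additive invariant of (1a)+(1b)+(3) that
      fails (2) is known to this seat (window / weighted evaluations die on the `1 → 0` Newton–Leibniz
      move); Ayoub / Fresán recover rule (2) from Stokes in one more variable in the VARIETY formalism,
      which suggests (c) may even be TRUE; recorded as an open side question, not pursued.
* §5 NATURAL STRENGTHENINGS: exponent uniformly `N = 0` ↔ the summit (`strengtheningN0_iff_summit`);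
  `N ≤ 1` / bounded `N`: implied by the summit, unrefutable here.
* §6 WHAT A KILL MUST BE (`not_ayoubPiLocalKernel_iff_shiftInvariant`): `¬ AyoubPiLocalKernel` iff
  there is an additive invariant `φ : FormalRep →+ A` of the four moves together with an INJECTIVE
  additive self-map `u` of `A` such that `φ ([π] * x) = u (φ x)` ("`[π]`-shift-injective exotic
  integral") and `φ c ≠ 0` on some `c` of value `0`. `eval` is such a pair (`u = π •`), and it is the
  ONLY one known: every additive invariant of the four moves in the tree is `λ · eval` on the classes
  it has been computed on (parent crux 2837's Disproof §4, §8, §15: no `ℤ`-valued / finite / profinite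
  invariant exists at all, the formal period group being divisible and torsion-free). Ring form of
  the same criterion: ideator-2's `nilLocalKernel_iff_primes` + `locallyReduced_of_isReduced`
  (`Cruxes/AyoubPiLocalKernel/SketchIdeator2.lean`), ideator-1's `piLocalKernel_iff :
  PiLocalKernel ↔ GenericPiKernel ∧ NoPiEigenvalues` (`IdeasSketch_r1_k1.lean`).
* §7 WHY IT RESISTS (`resists`, docstring): (i) no mis-formalisation — unique pinned family, sound
  moves, statement = `KZ.PiLocalKernel` = Ayoub Conj. 7 for this calculus; (ii) degenerate regimes —
  dimension `0` (algebraic constants: integrand additivity), null domains, dimension `≤ 1` rational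
  (a THEOREM with `N = 0`, Baker: `ayoubPiLocalKernel_on_dim_le_one`, p124986) all satisfy it;
  (iii) every refutation is a disproof of the Kontsevich–Zagier period conjecture
  (`ayoubPiLocalKernel_of_summit`) AND needs the exotic invariant of §6, of which none is in print
  ("we have nothing to say about this conjecture", Huber–Müller-Stach 2017, Preface p. xvi; Ayoub 2014
  Rem. 8: "widely open and desperately out of reach"); (iv) small/finite models do not exist — the
  statement quantifies over one fixed uncountable presented group; `decide`-style attacks are void.
* PICKED LINE `nilradical-cut` (lead, 2026-08-17; stubs `NilLocalKernel`, `LocallyReducedOnTorsion`):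
  both stubs are implied by the summit (`Ideator2.nil_and_reduced_of_kernel`), so neither is
  refutable short of ¬Conjecture 1; `LocallyReducedOnTorsion` is transcendence-free but a
  counterexample to it is again a non-membership-in-`relations` statement for a class of value `0`
  (`ϖ^N x` with `evalP x = 0`), i.e. needs the §6 invariant. No stub kill; see `-- Targets`.

LANDED (tree, `Theorems/AyoubPiLocalKernel/Negative/`, all `--supports` 0541, accepted 2026-08-17):
`LoadBearing.lean` (p138738: §0–§3, §3b, §5 with the mutated statements INLINED — `pinned_unique`,
`eval_lift_iterate`, `eval_eq_zero_of_lift_iterate_mem`, `ayoubPiLocalKernel_iff_forall_iff`,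
`ayoubPiLocalKernel_false_without_evalZero`, `withoutPinning_iff_kzKernelConjecture`/`_iff_summit`,
`natLocalKernel_zero`, `natLocalKernel_iff_kzKernelConjecture`, `exponentZero_iff_kzKernelConjecture`),
`Subcalculi.lean` (p138808: §4 — `not_piLocalKernel_covNL`, `not_piLocalKernel_noNL`,
`closure_noNL_le_ker_gradedEval`, `lift_iterate_of`), `KillShape.lean` (p138865: §6 —
`not_ayoubPiLocalKernel_iff_exists_shiftInvariant`, `eval_is_shiftInvariant`). Ideators / planners may
import those modules; this work file keeps self-contained copies under its own namespace.

Imports are landed tree files only; every `theorem` below is sorry-free (no NEAR-MISS this cycle).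
-/

noncomputable section

set_option linter.dupNamespace false

open Literature.NumberTheory.Transcendental
open Literature.NumberTheory.Transcendental.KZ
open MeasureTheory Set

namespace Summit.KontsevichZagierPeriods.KontsevichZagierPeriods.Cruxes.AyoubPiLocalKernel.Disproof

open Summit.KontsevichZagierPeriods.KontsevichZagierPeriods.Theses.LiouvilleUnfolding
  (AyoubPiLocalKernel AyoubPiCancellation LogKernelConjecture)
open Summit.KontsevichZagierPeriods.KontsevichZagierPeriods.BetaCancellationLine
  (exists_pinned piRep_mul_sub_lift_mem_relations lift_mem_relations_iff pinned_eq_piRep_prod_reindex)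
open Summit.KontsevichZagierPeriods.LiouvilleUnfolding.PiLocalKernelPosition
  (ayoubPiLocalKernel_iff_piLocalKernel ayoubPiLocalKernel_of_summit
    summit_iff_ayoubPiLocalKernel_and_ayoubPiCancellation)

/-! ## §0 Vocabulary -/

/-- The pinning hypothesis of the crux, verbatim: `P n r = [unit disc] × r`, disc in the two leading
coordinates of `Fin (n + 2)`. -/
def IsPinned (P : ∀ n : ℕ, IntegralRep n → IntegralRep (n + 2)) : Prop :=
  ∀ (n : ℕ) (r : IntegralRep n),
    (P n r).domain = {z : Fin (n + 2) → ℝ | z 0 ^ 2 + z 1 ^ 2 ≤ 1 ∧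
        (fun i : Fin n => z i.succ.succ) ∈ r.domain} ∧
      (P n r).integrand = fun z => r.integrand (fun i : Fin n => z i.succ.succ)

/-- The endomorphism `lift (of ∘ P)` of the formal group iterated in the crux. -/
def liftP (P : ∀ n : ℕ, IntegralRep n → IntegralRep (n + 2)) : FormalRep →+ FormalRep :=
  FreeAbelianGroup.lift (fun s : (Σ n, IntegralRep n) => of (P s.1 s.2))

/-- The crux, unfolded into this file's vocabulary (definitional). -/
theorem ayoubPiLocalKernel_iff :
    AyoubPiLocalKernel ↔ ∀ P, IsPinned P → ∀ c : FormalRep, eval c = 0 →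
      ∃ N : ℕ, (liftP P)^[N] c ∈ relations :=
  Iff.rfl

/-- `liftP P` on a generator. -/
@[simp] theorem liftP_of (P : ∀ n : ℕ, IntegralRep n → IntegralRep (n + 2)) {n : ℕ}
    (r : IntegralRep n) : liftP P (of r) = of (P n r) :=
  FreeAbelianGroup.lift_apply_of _ _

/-- `liftP P` on a sigma generator. -/
@[simp] theorem liftP_of' (P : ∀ n : ℕ, IntegralRep n → IntegralRep (n + 2))
    (s : Σ n, IntegralRep n) : liftP P (FreeAbelianGroup.of s) = of (P s.1 s.2) :=
  FreeAbelianGroup.lift_apply_of _ _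

/-- **The pinned family is unique**: two pinned families are equal (domain and integrand are pinned,
the remaining fields of `IntegralRep` are proofs). So the crux's `∀ P, IsPinned P → …` ranges over
exactly one object, inhabited by `BetaCancellationLine.exists_pinned`. [folklore] -/
theorem isPinned_unique {P P' : ∀ n : ℕ, IntegralRep n → IntegralRep (n + 2)}
    (hP : IsPinned P) (hP' : IsPinned P') : P = P' := by
  funext n r
  rw [pinned_eq_piRep_prod_reindex P hP n r, pinned_eq_piRep_prod_reindex P' hP' n r]

/-- The pinned family exists (restated). -/
theorem exists_isPinned : ∃ P, IsPinned P := exists_pinned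

/-! ## §1 Soundness side: the conclusion forces the hypothesis (tightness) -/

/-- `eval ∘ liftP P = π · eval` for a pinned family: `liftP P c ≡ [π] * c` modulo relations
(`piRep_mul_sub_lift_mem_relations`), relations evaluate to `0`, and `eval ([π] * c) = π · eval c`
(Fubini, `KZ.eval_piRep_mul`). [folklore] -/
theorem eval_liftP (P : ∀ n : ℕ, IntegralRep n → IntegralRep (n + 2)) (hP : IsPinned P)
    (c : FormalRep) : eval (liftP P c) = Real.pi * eval c := by
  have h0 : eval (of piRep * c - liftP P c) = 0 :=
    relations_le_ker_eval_holds (piRep_mul_sub_lift_mem_relations P hP c)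
  rw [map_sub, eval_piRep_mul, sub_eq_zero] at h0
  exact h0.symm

/-- `eval ((liftP P)^[N] c) = π ^ N · eval c`. [folklore] -/
theorem eval_liftP_iterate (P : ∀ n : ℕ, IntegralRep n → IntegralRep (n + 2)) (hP : IsPinned P)
    (N : ℕ) (c : FormalRep) : eval ((liftP P)^[N] c) = Real.pi ^ N * eval c := by
  induction N with
  | zero => simp
  | succ N ih => rw [Function.iterate_succ_apply', eval_liftP P hP, ih, pow_succ]; ring

/-- The value of a pinned multiple: `value (P n r) = π · value r`. [folklore] -/
theorem value_pinned (P : ∀ n : ℕ, IntegralRep n → IntegralRep (n + 2)) (hP : IsPinned P)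
    {n : ℕ} (r : IntegralRep n) : (P n r).value = Real.pi * r.value := by
  have h := eval_liftP P hP (of r)
  rwa [liftP_of, eval_of, eval_of] at h

/-- **TIGHTNESS — the conclusion of the crux implies its hypothesis.** If some `[π]`-power multiple
of `c` is a relation then `eval c = 0` (soundness of the four moves and `π ≠ 0`). So `eval c = 0` is
the weakest possible hypothesis: the crux asserts the converse of a theorem. [folklore] -/
theorem eval_eq_zero_of_liftP_iterate_mem (P : ∀ n : ℕ, IntegralRep n → IntegralRep (n + 2))
    (hP : IsPinned P) {c : FormalRep} {N : ℕ} (h : (liftP P)^[N] c ∈ relations) : eval c = 0 := by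
  have h0 : eval ((liftP P)^[N] c) = 0 := relations_le_ker_eval_holds h
  rw [eval_liftP_iterate P hP] at h0
  exact (mul_eq_zero.mp h0).resolve_left (pow_ne_zero _ Real.pi_ne_zero)

/-- The crux as an `iff` per element: `AyoubPiLocalKernel ↔ ∀ P pinned, ∀ c,
(eval c = 0 ↔ ∃ N, (liftP P)^[N] c ∈ relations)`. [folklore] -/
theorem ayoubPiLocalKernel_iff_forall_iff :
    AyoubPiLocalKernel ↔ ∀ P, IsPinned P → ∀ c : FormalRep,
      (eval c = 0 ↔ ∃ N : ℕ, (liftP P)^[N] c ∈ relations) := by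
  rw [ayoubPiLocalKernel_iff]
  refine forall₂_congr fun P hP => forall_congr' fun c => ?_
  exact ⟨fun h => ⟨h, fun ⟨N, hN⟩ => eval_eq_zero_of_liftP_iterate_mem P hP hN⟩, fun h => h.1⟩

/-! ## §2 Load-bearing hypothesis `eval c = 0` -/

/-- The crux with the hypothesis `eval c = 0` deleted. -/
def AyoubPiLocalKernelWithoutEvalZero : Prop :=
  ∀ P, IsPinned P → ∀ c : FormalRep, ∃ N : ℕ, (liftP P)^[N] c ∈ relations

/-- **Any proof must use `eval c = 0`**: without it the statement is false. Witness: the pinned family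
itself and `c = [π]` (value `π ≠ 0`); by §1 no `[π]`-power multiple of it is a relation. [folklore] -/
theorem ayoubPiLocalKernel_false_without_evalZero : ¬ AyoubPiLocalKernelWithoutEvalZero := by
  intro h
  obtain ⟨P, hP⟩ := exists_isPinned
  obtain ⟨N, hN⟩ := h P hP (of piRep)
  have h0 := eval_eq_zero_of_liftP_iterate_mem P hP hN
  rw [eval_of_piRep] at h0
  exact Real.pi_ne_zero h0

/-- Sharper: for EVERY `c` of non-zero value and every `N`, `(liftP P)^[N] c ∉ relations`. -/
theorem liftP_iterate_not_mem_of_eval_ne_zero (P : ∀ n : ℕ, IntegralRep n → IntegralRep (n + 2))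
    (hP : IsPinned P) {c : FormalRep} (hc : eval c ≠ 0) (N : ℕ) :
    (liftP P)^[N] c ∉ relations :=
  fun h => hc (eval_eq_zero_of_liftP_iterate_mem P hP h)

/-! ## §3 Load-bearing pinning: without `IsPinned` the statement is the summit's kernel form -/

/-- The crux with the pinning hypothesis deleted: ANY dimension-raising family `P` is allowed. -/
def AyoubPiLocalKernelAnyFamily : Prop :=
  ∀ (P : ∀ n : ℕ, IntegralRep n → IntegralRep (n + 2)) (c : FormalRep), eval c = 0 →
    ∃ N : ℕ, (liftP P)^[N] c ∈ relations

/-- The witness family for §3: two slabs, `P n r := (r.slab 0).slab 0 = [σ × [0,1] × [0,1], f ∘ pr]`,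
which differs from `r` by two Newton–Leibniz moves. -/
def slabFamily : ∀ n : ℕ, IntegralRep n → IntegralRep (n + 2) := fun _ r => (r.slab 0).slab 0

/-- `[slabFamily r] − [r] ∈ relations` (two rule-(3) moves, `of_slab_sub_of_mem_newtonLeibnizRel`). -/
theorem of_slabFamily_sub_mem {n : ℕ} (r : IntegralRep n) :
    of (slabFamily n r) - of r ∈ relations := by
  have h1 : of ((r.slab 0).slab 0) - of (r.slab 0) ∈ relations :=
    newtonLeibnizRel_subset_relations ((r.slab 0).of_slab_sub_of_mem_newtonLeibnizRel 0)
  have h2 : of (r.slab 0) - of r ∈ relations :=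
    newtonLeibnizRel_subset_relations (r.of_slab_sub_of_mem_newtonLeibnizRel 0)
  have e : of (slabFamily n r) - of r =
      (of ((r.slab 0).slab 0) - of (r.slab 0)) + (of (r.slab 0) - of r) := by
    simp only [slabFamily]; abel
  rw [e]
  exact relations.add_mem h1 h2

/-- `liftP slabFamily c − c ∈ relations` for every formal combination. -/
theorem liftP_slabFamily_sub_mem (c : FormalRep) : liftP slabFamily c - c ∈ relations := by
  induction c using FreeAbelianGroup.induction_on with
  | zero => simp [relations.zero_mem]
  | of s =>
    obtain ⟨n, r⟩ := s
    rw [liftP_of']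
    exact of_slabFamily_sub_mem r
  | neg s ih =>
    have e : liftP slabFamily (-FreeAbelianGroup.of s) - -FreeAbelianGroup.of s =
        -(liftP slabFamily (FreeAbelianGroup.of s) - FreeAbelianGroup.of s) := by
      rw [map_neg]; abel
    rw [e]
    exact relations.neg_mem ih
  | add x y hx hy =>
    rw [map_add]
    have e : liftP slabFamily x + liftP slabFamily y - (x + y) =
        (liftP slabFamily x - x) + (liftP slabFamily y - y) := by abel
    rw [e]
    exact relations.add_mem hx hy

/-- `(liftP slabFamily)^[N] c − c ∈ relations`. -/
theorem liftP_slabFamily_iterate_sub_mem (N : ℕ) (c : FormalRep) :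
    (liftP slabFamily)^[N] c - c ∈ relations := by
  induction N with
  | zero => simp [relations.zero_mem]
  | succ N ih =>
    rw [Function.iterate_succ_apply']
    have e : liftP slabFamily ((liftP slabFamily)^[N] c) - c =
        (liftP slabFamily ((liftP slabFamily)^[N] c) - (liftP slabFamily)^[N] c) +
          ((liftP slabFamily)^[N] c - c) := by abel
    rw [e]
    exact relations.add_mem (liftP_slabFamily_sub_mem _) ih

/-- **Dropping the pinning turns the crux into the summit's kernel form**:
`AyoubPiLocalKernelAnyFamily ↔ KZKernelConjecture`. (`→`: at the slab family the iterates are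
`≡ c`; `←`: exponent `N = 0`.) Hence no `_false_without_pinning` theorem can exist short of
disproving Kontsevich–Zagier's Conjecture 1, and whatever makes item 0541 weaker than the summit is
carried entirely by the particular multiplier `[π]`. [folklore] -/
theorem anyFamily_iff_kzKernelConjecture : AyoubPiLocalKernelAnyFamily ↔ KZKernelConjecture := by
  constructor
  · intro h c hc
    obtain ⟨N, hN⟩ := h slabFamily c hc
    have := relations.sub_mem hN (liftP_slabFamily_iterate_sub_mem N c)
    simpa using this
  · intro h P c hc
    exact ⟨0, h c hc⟩

/-- Consequently the un-pinned statement is equivalent to the summit. [folklore] -/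
theorem anyFamily_iff_summit : AyoubPiLocalKernelAnyFamily ↔ _root_.KontsevichZagierPeriods :=
  anyFamily_iff_kzKernelConjecture.trans
    (kzKernelConjecture_iff_isRational : KZKernelConjecture ↔ _root_.KontsevichZagierPeriods)

/-- … and implies the crux (the crux is its specialisation to the pinned family). -/
theorem ayoubPiLocalKernel_of_anyFamily (h : AyoubPiLocalKernelAnyFamily) : AyoubPiLocalKernel :=
  fun P _ c hc => h P c hc


/-! ### §3b Localising at an integer instead of `[π]` is no localisation at all -/

/-- "`ker eval` is `k`-power torsion modulo relations": the crux with the multiplier `[π]` replaced by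
the integer `k` (equivalently, by any representation of KZ-rational value `k`, e.g. `[[0,k] × σ, f]`,
`KZ.IntegralRep.of_constMul_nat_sub_nsmul_mem_relations`). -/
def LocalKernelAtNat (k : ℕ) : Prop :=
  ∀ c : FormalRep, eval c = 0 → ∃ N : ℕ, (k ^ N) • c ∈ relations

/-- Degenerate multiplier: at `k = 0` the local statement is TRIVIALLY TRUE (everything dies after one
multiplication) — the analogue of pinning at a null disc. [folklore] -/
theorem localKernelAtNat_zero : LocalKernelAtNat 0 :=
  fun c _ => ⟨1, by simp [relations.zero_mem]⟩

/-- **At every integer `k ≥ 1` the local statement is the summit's kernel form** (no torsion in the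
formal period group: `MzvKernelInKZ.Negative.mem_relations_of_nsmul_mem`, integer division is a derived
rule of the four moves). So a multiplier can weaken Conjecture 1 only through a value that is NOT
cancellable by the four moves; for `[π]` that cancellability is exactly the open sibling item 0540.
[folklore] -/
theorem localKernelAtNat_iff_kzKernelConjecture {k : ℕ} (hk : 0 < k) :
    LocalKernelAtNat k ↔ KZKernelConjecture := by
  constructor
  · intro h c hc
    obtain ⟨N, hN⟩ := h c hc
    exact Summit.KontsevichZagierPeriods.MzvKernelInKZ.Negative.mem_relations_of_nsmul_mem
      (pow_pos hk N) hN
  · intro h c hc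
    exact ⟨0, by simpa using h c hc⟩

/-! ## §4 The constant `KZ.relations`: which moves a `[π]`-local certificate needs -/

/-- The rational constant `q` in dimension `0`: `[ℝ⁰, q]`, value `q` (copy of the Barriers file's
`constRep`, kept local to avoid its `Mathlib.Computability` imports). [folklore] -/
def constRep0 (q : ℚ) : IntegralRep 0 :=
  IntegralRep.ofRational univ (MvPolynomial.C q) 1
    Literature.ModelTheory.ExponentialFields.isSemialgebraic_univ (fun _ _ => by simp) (by simp)

/-- Lebesgue measure of `ℝ⁰ = {pt}` is `1`. [folklore] -/
theorem volume_univ_fin_zero : volume (univ : Set (Fin 0 → ℝ)) = 1 := by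
  rw [volume_pi, Measure.pi_univ]
  simp

/-- `value [ℝ⁰, q] = q`. [folklore] -/
@[simp] theorem constRep0_value (q : ℚ) : (constRep0 q).value = q := by
  simp only [constRep0, IntegralRep.value_ofRational]
  simp [Measure.real, volume_univ_fin_zero]

/-- `[ℝ⁰, 0] ∈ relations` (integrand `≡ 0`): the §4(a) witness IS a kernel element settled by the full
calculus with `N = 0`. [folklore] -/
theorem of_constRep0_zero_mem_relations : of (constRep0 0) ∈ relations :=
  of_mem_relations_of_eqOn_zero _ fun x _ => by simp [constRep0]

/-! ### §4(a) Without the additivity moves: FALSE (invariant `coeffSum`) -/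

/-- The sub-calculus generated by change of variables (2) and Newton–Leibniz (3) only. -/
def relationsCovNL : AddSubgroup FormalRep :=
  AddSubgroup.closure (changeOfVariablesRel ∪ newtonLeibnizRel)

theorem relationsCovNL_le_relations : relationsCovNL ≤ relations :=
  AddSubgroup.closure_mono fun _ hx => hx.elim (fun h => Or.inl (Or.inr h)) Or.inr

/-- `liftP P` maps generators to generators, so it preserves the coefficient sum. [folklore] -/
theorem coeffSum_liftP (P : ∀ n : ℕ, IntegralRep n → IntegralRep (n + 2)) (c : FormalRep) :
    coeffSum (liftP P c) = coeffSum c := by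
  induction c using FreeAbelianGroup.induction_on with
  | zero => simp
  | of s =>
    rw [liftP_of', coeffSum_of]
    exact (FreeAbelianGroup.lift_apply_of _ _).symm
  | neg s ih => rw [map_neg, map_neg, map_neg, ih]
  | add x y hx hy => rw [map_add, map_add, map_add, hx, hy]

theorem coeffSum_liftP_iterate (P : ∀ n : ℕ, IntegralRep n → IntegralRep (n + 2)) (N : ℕ)
    (c : FormalRep) : coeffSum ((liftP P)^[N] c) = coeffSum c := by
  induction N with
  | zero => rfl
  | succ N ih => rw [Function.iterate_succ_apply', coeffSum_liftP, ih]

/-- The `[π]`-local kernel statement for the ADDITIVITY-FREE sub-calculus (moves (2)+(3) only). -/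
def PiLocalKernelCovNL : Prop :=
  ∀ P, IsPinned P → ∀ c : FormalRep, eval c = 0 → ∃ N : ℕ, (liftP P)^[N] c ∈ relationsCovNL

/-- **Additivity is load-bearing even `[π]`-locally**: the crux restricted to certificates using only
rules (2)+(3) is FALSE. Witness `c = [ℝ⁰, 0]` (value `0`, a relation of the full calculus): every
`[π]`-power multiple of it is a single generator, of coefficient sum `1`, while rules (2)+(3) preserve
the coefficient sum (`KZ.closure_cov_nl_le_ker_coeffSum`). [folklore] -/
theorem not_piLocalKernelCovNL : ¬ PiLocalKernelCovNL := by
  intro h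
  obtain ⟨P, hP⟩ := exists_isPinned
  have h0 : eval (of (constRep0 0)) = 0 := by simp
  obtain ⟨N, hN⟩ := h P hP _ h0
  have h1 : coeffSum ((liftP P)^[N] (of (constRep0 0))) = 0 := closure_cov_nl_le_ker_coeffSum hN
  rw [coeffSum_liftP_iterate, coeffSum_of] at h1
  exact one_ne_zero h1

/-! ### §4(b) Without Newton–Leibniz: FALSE (invariant: dimension-graded evaluation) -/

/-- **Dimension-graded evaluation**: the value of the dimension-`k` part of a formal combination.
Moves (1a), (1b), (2) relate generators of ONE dimension and evaluate to `0`, so they preserve every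
`evalDim k`; Newton–Leibniz (3) does not (`[[0,1],1] − [pt,1]`). [folklore] -/
def evalDim (k : ℕ) : FormalRep →+ ℝ :=
  FreeAbelianGroup.lift fun s : (Σ n, IntegralRep n) => if s.1 = k then s.2.value else 0

@[simp] theorem evalDim_of' (k : ℕ) (s : Σ n, IntegralRep n) :
    evalDim k (FreeAbelianGroup.of s) = if s.1 = k then s.2.value else 0 :=
  FreeAbelianGroup.lift_apply_of _ _

@[simp] theorem evalDim_of (k : ℕ) {n : ℕ} (r : IntegralRep n) :
    evalDim k (of r) = if n = k then r.value else 0 :=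
  FreeAbelianGroup.lift_apply_of _ _

theorem evalDim_eq_zero_of_mem_domainAddRel (k : ℕ) {c : FormalRep} (hc : c ∈ domainAddRel) :
    evalDim k c = 0 := by
  have h0 : eval c = 0 := eval_eq_zero_of_mem_domainAddRel_holds hc
  obtain ⟨n, r, r₁, r₂, -, -, -, -, rfl⟩ := hc
  simp only [map_sub, eval_of, evalDim_of] at h0 ⊢
  split_ifs
  · exact h0
  · simp

theorem evalDim_eq_zero_of_mem_integrandAddRel (k : ℕ) {c : FormalRep} (hc : c ∈ integrandAddRel) :
    evalDim k c = 0 := by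
  have h0 : eval c = 0 := eval_eq_zero_of_mem_integrandAddRel_holds hc
  obtain ⟨n, r, r₁, r₂, -, -, -, rfl⟩ := hc
  simp only [map_sub, eval_of, evalDim_of] at h0 ⊢
  split_ifs
  · exact h0
  · simp

theorem evalDim_eq_zero_of_mem_changeOfVariablesRel (k : ℕ) {c : FormalRep}
    (hc : c ∈ changeOfVariablesRel) : evalDim k c = 0 := by
  have h0 : eval c = 0 := eval_eq_zero_of_mem_changeOfVariablesRel_holds hc
  obtain ⟨n, r, r', Φ, Φ', -, -, -, -, -, rfl⟩ := hc
  simp only [map_sub, eval_of, evalDim_of] at h0 ⊢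
  split_ifs
  · exact h0
  · simp

/-- The sub-calculus generated WITHOUT Newton–Leibniz: moves (1a), (1b), (2). -/
def relationsNoNL : AddSubgroup FormalRep :=
  AddSubgroup.closure (domainAddRel ∪ integrandAddRel ∪ changeOfVariablesRel)

theorem relationsNoNL_le_relations : relationsNoNL ≤ relations :=
  AddSubgroup.closure_mono fun _ hx => Or.inl hx

/-- Moves (1a)+(1b)+(2) preserve every graded evaluation. [folklore] -/
theorem relationsNoNL_le_ker_evalDim (k : ℕ) : relationsNoNL ≤ (evalDim k).ker := by
  refine (AddSubgroup.closure_le _).mpr ?_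
  rintro c ((hc | hc) | hc)
  · exact evalDim_eq_zero_of_mem_domainAddRel k hc
  · exact evalDim_eq_zero_of_mem_integrandAddRel k hc
  · exact evalDim_eq_zero_of_mem_changeOfVariablesRel k hc

/-- Iterating a dimension-raising family on a sigma generator. -/
def iterSigma (P : ∀ n : ℕ, IntegralRep n → IntegralRep (n + 2)) :
    ℕ → (Σ n, IntegralRep n) → (Σ n, IntegralRep n)
  | 0, s => s
  | N + 1, s => ⟨(iterSigma P N s).1 + 2, P _ (iterSigma P N s).2⟩

@[simp] theorem iterSigma_zero (P : ∀ n : ℕ, IntegralRep n → IntegralRep (n + 2))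
    (s : Σ n, IntegralRep n) : iterSigma P 0 s = s := rfl

@[simp] theorem iterSigma_succ (P : ∀ n : ℕ, IntegralRep n → IntegralRep (n + 2)) (N : ℕ)
    (s : Σ n, IntegralRep n) :
    iterSigma P (N + 1) s = ⟨(iterSigma P N s).1 + 2, P _ (iterSigma P N s).2⟩ := rfl

/-- Each step raises the dimension by `2`. -/
theorem iterSigma_fst (P : ∀ n : ℕ, IntegralRep n → IntegralRep (n + 2)) (N : ℕ)
    (s : Σ n, IntegralRep n) : (iterSigma P N s).1 = s.1 + 2 * N := by
  induction N with
  | zero => simp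
  | succ N ih => simp only [iterSigma_succ, ih]; ring

/-- `(liftP P)^[N]` on a generator is the generator `iterSigma P N`. -/
theorem liftP_iterate_of' (P : ∀ n : ℕ, IntegralRep n → IntegralRep (n + 2)) (N : ℕ)
    (s : Σ n, IntegralRep n) :
    (liftP P)^[N] (FreeAbelianGroup.of s) = FreeAbelianGroup.of (iterSigma P N s) := by
  induction N with
  | zero => rfl
  | succ N ih => rw [Function.iterate_succ_apply', ih, liftP_of', iterSigma_succ]; rfl

/-- Each pinned step multiplies the value by `π`. -/
theorem value_iterSigma (P : ∀ n : ℕ, IntegralRep n → IntegralRep (n + 2)) (hP : IsPinned P)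
    (N : ℕ) (s : Σ n, IntegralRep n) :
    (iterSigma P N s).2.value = Real.pi ^ N * s.2.value := by
  induction N with
  | zero => simp
  | succ N ih =>
    rw [iterSigma_succ]
    dsimp only
    rw [value_pinned P hP, ih, pow_succ]
    ring

/-- Iterates of an additive map are additive (subtraction form). -/
theorem iterate_map_sub (f : FormalRep →+ FormalRep) (N : ℕ) (x y : FormalRep) :
    (⇑f)^[N] (x - y) = (⇑f)^[N] x - (⇑f)^[N] y := by
  induction N with
  | zero => rfl
  | succ N ih => simp only [Function.iterate_succ_apply', ih, map_sub]

/-- `[ℝ⁰ × [0,1], 1]`, the slab over the unit constant: dimension `1`, value `1`. -/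
def unitIntervalRep : IntegralRep 1 := (constRep0 1).slab 0

/-- `[[0,1], 1] − [pt, 1]` is ONE printed rule-(3) move. -/
theorem of_unitIntervalRep_sub_mem_newtonLeibnizRel :
    of unitIntervalRep - of (constRep0 1) ∈ newtonLeibnizRel :=
  (constRep0 1).of_slab_sub_of_mem_newtonLeibnizRel 0

/-- The §4(b) witness `[[0,1], 1] − [pt, 1]`. -/
def nlWitness : FormalRep := of unitIntervalRep - of (constRep0 1)

/-- The witness is a relation of the FULL calculus (so the crux's conclusion holds for it, `N = 0`)… -/
theorem nlWitness_mem_relations : nlWitness ∈ relations :=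
  newtonLeibnizRel_subset_relations of_unitIntervalRep_sub_mem_newtonLeibnizRel

/-- … in particular it lies in `ker eval`. -/
theorem eval_nlWitness : eval nlWitness = 0 := relations_le_ker_eval_holds nlWitness_mem_relations

/-- … but NO `[π]`-power multiple of it lies in the Newton–Leibniz-free sub-calculus: the graded
evaluation in dimension `2N` sees `−π^N ≠ 0` (the disc-powers of `[pt,1]` live in dimension `2N`,
those of `[[0,1],1]` in dimension `2N + 1`). [folklore] -/
theorem liftP_iterate_nlWitness_not_mem (P : ∀ n : ℕ, IntegralRep n → IntegralRep (n + 2))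
    (hP : IsPinned P) (N : ℕ) : (liftP P)^[N] nlWitness ∉ relationsNoNL := by
  intro h
  have e : (liftP P)^[N] nlWitness =
      FreeAbelianGroup.of (iterSigma P N ⟨1, unitIntervalRep⟩) -
        FreeAbelianGroup.of (iterSigma P N ⟨0, constRep0 1⟩) := by
    simp only [nlWitness, KZ.of, iterate_map_sub, liftP_iterate_of']
  have h0 : evalDim (0 + 2 * N) ((liftP P)^[N] nlWitness) = 0 := relationsNoNL_le_ker_evalDim _ h
  rw [e, map_sub, evalDim_of', evalDim_of',
    if_neg (show (iterSigma P N ⟨1, unitIntervalRep⟩).fst ≠ 0 + 2 * N by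
      rw [iterSigma_fst]; show (1 : ℕ) + 2 * N ≠ 0 + 2 * N; omega),
    if_pos (show (iterSigma P N ⟨0, constRep0 1⟩).fst = 0 + 2 * N by rw [iterSigma_fst]),
    value_iterSigma P hP, zero_sub, neg_eq_zero] at h0
  -- `h0 : π ^ N * value [pt, 1] = 0`, absurd since `π ≠ 0`
  simp at h0

/-- The `[π]`-local kernel statement for the NEWTON–LEIBNIZ-FREE sub-calculus. -/
def PiLocalKernelNoNL : Prop :=
  ∀ P, IsPinned P → ∀ c : FormalRep, eval c = 0 → ∃ N : ℕ, (liftP P)^[N] c ∈ relationsNoNL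

/-- **Newton–Leibniz is load-bearing even `[π]`-locally**: the crux restricted to certificates using
only rules (1a)+(1b)+(2) is FALSE (witness `nlWitness`). So every `[π]`-local certificate of a
dimension-mixing identity contains printed rule (3); multiplying by discs never replaces it. [folklore] -/
theorem not_piLocalKernelNoNL : ¬ PiLocalKernelNoNL := by
  intro h
  obtain ⟨P, hP⟩ := exists_isPinned
  obtain ⟨N, hN⟩ := h P hP nlWitness eval_nlWitness
  exact liftP_iterate_nlWitness_not_mem P hP N hN

/-! ## §5 Natural strengthenings -/

/-- The crux with the exponent pinned to `N = 0`. -/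
def AyoubPiLocalKernelN0 : Prop :=
  ∀ P, IsPinned P → ∀ c : FormalRep, eval c = 0 → (liftP P)^[0] c ∈ relations

/-- **Exponent `0` is the summit**: `AyoubPiLocalKernelN0 ↔ KZKernelConjecture` (the pinned family
exists, and `f^[0] = id`). [folklore] -/
theorem strengtheningN0_iff_kzKernelConjecture : AyoubPiLocalKernelN0 ↔ KZKernelConjecture := by
  constructor
  · intro h c hc
    obtain ⟨P, hP⟩ := exists_isPinned
    simpa using h P hP c hc
  · intro h P _ c hc
    simpa using h c hc

theorem strengtheningN0_iff_summit : AyoubPiLocalKernelN0 ↔ _root_.KontsevichZagierPeriods :=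
  strengtheningN0_iff_kzKernelConjecture.trans
    (kzKernelConjecture_iff_isRational : KZKernelConjecture ↔ _root_.KontsevichZagierPeriods)

/-- Position: summit ⇒ crux (tree), crux ⇐ `N = 0`-strengthening = summit; the crux sits between the
summit and … nothing known below it. [folklore] -/
theorem ayoubPiLocalKernel_of_N0 (h : AyoubPiLocalKernelN0) : AyoubPiLocalKernel :=
  fun P hP c hc => ⟨0, h P hP c hc⟩

/-! ## §6 What a kill must be: a `[π]`-shift-injective exotic additive invariant -/

/-- **Kill shape.** An additive invariant `φ` of the four moves with values in an abelian group `A`,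
intertwining left multiplication by the disc with an INJECTIVE additive self-map `u` of `A`, and
non-zero on some formal combination of value `0`. (`eval` with `u = (π • ·)` has every property but
the last.) -/
structure ShiftInvariantWitness where
  /-- the value group -/
  A : Type
  [inst : AddCommGroup A]
  /-- the exotic "integral" -/
  φ : FormalRep →+ A
  /-- the shift standing in for "multiplication by `π`" -/
  u : A →+ A
  hu : Function.Injective u
  hrel : ∀ x ∈ relations, φ x = 0
  hshift : ∀ x : FormalRep, φ (of piRep * x) = u (φ x)
  /-- the combination it detects -/
  c : FormalRep
  hc : eval c = 0
  hφc : φ c ≠ 0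

attribute [instance] ShiftInvariantWitness.inst

theorem ShiftInvariantWitness.φ_iterate (w : ShiftInvariantWitness) (N : ℕ) (x : FormalRep) :
    w.φ ((fun y => of piRep * y)^[N] x) = (⇑w.u)^[N] (w.φ x) := by
  induction N with
  | zero => rfl
  | succ N ih => rw [Function.iterate_succ_apply', Function.iterate_succ_apply', w.hshift, ih]

/-- **Criterion.** `¬ AyoubPiLocalKernel ↔` a `ShiftInvariantWitness` exists. `←`: `φ` kills every
`[π]^N ⋆ c ∈ relations` while `u^[N] (φ c) ≠ 0`. `→`: take `A := P[ϖ⁻¹]` (the formal period ring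
localised at the class `ϖ` of the disc, as an additive group), `φ` the canonical map, `u := (ϖ • ·)`
(a unit there); `φ c = 0` would mean `ϖ^N ⋆ c ∈ relations` (`IsLocalization.map_eq_zero_iff`).
So disproving 0541 means CONSTRUCTING an exotic additive integral of the four-move calculus on which
the disc acts injectively — none is known; every additive move-invariant in the tree is `λ · eval`
where computed (parent Disproof §4/§8/§15). [folklore] -/
theorem not_ayoubPiLocalKernel_iff_shiftInvariant :
    ¬ AyoubPiLocalKernel ↔ Nonempty ShiftInvariantWitness := by
  rw [ayoubPiLocalKernel_iff_piLocalKernel]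
  constructor
  · intro h
    unfold PiLocalKernel at h
    push Not at h
    obtain ⟨c, hc, hN⟩ := h
    set ϖ : FormalPeriodRing := toFormalPeriod (of piRep) with hϖ
    let L := Localization.Away ϖ
    have hunit : IsUnit (algebraMap FormalPeriodRing L ϖ) := IsLocalization.Away.algebraMap_isUnit ϖ
    refine ⟨{ A := L
              φ := (algebraMap FormalPeriodRing L).toAddMonoidHom.comp toFormalPeriod.toAddMonoidHom
              u := AddMonoidHom.mulLeft (algebraMap FormalPeriodRing L ϖ)
              hu := hunit.mul_right_injective
              hrel := fun x hx => ?_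
              hshift := fun x => ?_
              c := c
              hc := hc
              hφc := fun h0 => ?_ }⟩
    · change algebraMap FormalPeriodRing L (toFormalPeriod x) = 0
      rw [toFormalPeriod_eq_zero_iff.mpr hx, map_zero]
    · change algebraMap FormalPeriodRing L (toFormalPeriod (of piRep * x)) =
        algebraMap FormalPeriodRing L ϖ * algebraMap FormalPeriodRing L (toFormalPeriod x)
      rw [map_mul, map_mul]
    · change algebraMap FormalPeriodRing L (toFormalPeriod c) = 0 at h0
      rw [IsLocalization.map_eq_zero_iff (Submonoid.powers ϖ)] at h0
      obtain ⟨⟨m, N, rfl⟩, hm⟩ := h0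
      apply hN N
      rw [← toFormalPeriod_eq_zero_iff,
        Summit.KontsevichZagierPeriods.LiouvilleUnfolding.PiLocalKernelPosition.toFormalPeriod_iterate_piRep_mul]
      exact hm
  · rintro ⟨w⟩ h
    obtain ⟨N, hN⟩ := h w.c w.hc
    have h1 := w.hrel _ hN
    rw [w.φ_iterate] at h1
    have h2 : (⇑w.u)^[N] (w.φ w.c) = (⇑w.u)^[N] 0 := by
      rw [h1, iterate_map_zero]
    exact w.hφc (w.hu.iterate N h2)

/-! ## §7 Why it resists; Targets (picked line `nilradical-cut`) -/

/-- Copy of ideator-2's transcendence-free stub (`Cruxes/AyoubPiLocalKernel/SketchIdeator2.lean`,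
`LocallyReducedOnTorsion`; crux work files are not importable): no `ϖ`-local nilpotents among the
`ϖ`-locally nil classes. -/
def LocallyReducedOnTorsion : Prop :=
  ∀ x : FormalPeriodRing,
    (∃ N k : ℕ, toFormalPeriod (of piRep) ^ N * x ^ (k + 1) = 0) →
      ∃ N : ℕ, toFormalPeriod (of piRep) ^ N * x = 0

/-- Copy of ideator-2's transcendence stub `NilLocalKernel`. -/
def NilLocalKernel : Prop :=
  ∀ x : FormalPeriodRing, evalP x = 0 → ∃ N k : ℕ, toFormalPeriod (of piRep) ^ N * x ^ (k + 1) = 0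

/-- TARGET ANALYSIS — **a kill of the transcendence-free stub kills the crux** (and hence the
summit): the stub's hypothesis forces `evalP x = 0`, so a counterexample `x` is a class of value `0`
none of whose `ϖ`-power multiples vanishes, i.e. `¬ KZ.PiLocalKernel`. So `LocallyReducedOnTorsion`,
though "transcendence-free", is not refutable short of ¬Conjecture 1 either, and a refutation again
needs the §6 invariant. [folklore] -/
theorem not_piLocalKernel_of_not_locallyReducedOnTorsion (h : ¬ LocallyReducedOnTorsion) :
    ¬ PiLocalKernel := by
  intro hK
  apply h
  rintro x ⟨N, k, hNk⟩
  rw [Summit.KontsevichZagierPeriods.LiouvilleUnfolding.PiLocalKernelPosition.piLocalKernel_iff_forall_evalP]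
    at hK
  apply hK
  have h' := congrArg evalP hNk
  rw [map_mul, map_zero, map_pow, map_pow] at h'
  have hπ : evalP (toFormalPeriod (of piRep)) ≠ 0 :=
    Summit.KontsevichZagierPeriods.LiouvilleUnfolding.PiLocalKernelPosition.evalP_piClass_ne_zero
  exact (pow_eq_zero_iff (Nat.succ_ne_zero k)).mp ((mul_eq_zero.mp h').resolve_left (pow_ne_zero _ hπ))

/-- Both stubs of the picked line follow from the summit (so neither is refutable short of
¬Conjecture 1). [folklore] -/
theorem stubs_of_summit (h : _root_.KontsevichZagierPeriods) : NilLocalKernel ∧ LocallyReducedOnTorsion := by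
  have hK : KZKernelConjecture :=
    (kzKernelConjecture_iff_isRational : KZKernelConjecture ↔ _root_.KontsevichZagierPeriods).mpr h
  have hinj : ∀ x : FormalPeriodRing, evalP x = 0 → x = 0 := by
    intro x hx
    obtain ⟨c, rfl⟩ := toFormalPeriod_surjective x
    exact toFormalPeriod_eq_zero_iff.mpr (hK c hx)
  have hπ : evalP (toFormalPeriod (of piRep)) ≠ 0 :=
    Summit.KontsevichZagierPeriods.LiouvilleUnfolding.PiLocalKernelPosition.evalP_piClass_ne_zero
  refine ⟨fun x hx => ⟨0, 0, by simp [hinj x hx]⟩, ?_⟩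
  rintro x ⟨N, k, hNk⟩
  refine ⟨0, ?_⟩
  rw [pow_zero, one_mul]
  apply hinj
  have h' := congrArg evalP hNk
  rw [map_mul, map_zero, map_pow, map_pow] at h'
  exact (pow_eq_zero_iff (Nat.succ_ne_zero k)).mp ((mul_eq_zero.mp h').resolve_left (pow_ne_zero _ hπ))

/-- **WHY IT RESISTS (cycle 1).**
(i) No mis-formalisation to exploit: the pinned family is unique and inhabited (§0), the four moves
are sound, and the item is by name `KZ.PiLocalKernel` = Ayoub's Conjecture 7 for this calculus
(`ayoubPiLocalKernel_iff_piLocalKernel`); its conclusion implies its hypothesis (§1), so the statement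
is exactly "`eval` is injective on `(FormalRep ⧸ relations)[ϖ⁻¹]`".
(ii) Degenerate regimes all satisfy it: dimension-`0` generators are real algebraic constants and
`[pt,a] + [pt,b] ≡ [pt,a+b]`, `[pt,0] ≡ 0` (integrand additivity); null domains are relations
(`KZ.of_mem_relations_of_volume_eq_zero`); on the subgroup generated by KZ-rational representations
of dimension `≤ 1` the conclusion is a THEOREM with `N = 0` (Baker; `ayoubPiLocalKernel_on_dim_le_one`,
p124986/p135819). There is no finite or decidable model: the statement is about one fixed uncountable
presented group, so `decide`/enumeration attacks are void, and `kit compute` has nothing to certify.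
(iii) Hypothesis mutation produces only the expected pattern: `eval c = 0` dropped → false (§2);
pinning dropped → the summit (§3); integer multipliers → the summit (§3b); sub-calculi without
additivity / without Newton–Leibniz → false by cheap invariants (§4), which say only that certificates
must use those rules, not that the crux fails.
(iv) Every genuine refutation is simultaneously a disproof of Kontsevich–Zagier's Conjecture 1
(`ayoubPiLocalKernel_of_summit`) and the construction of a `[π]`-shift-injective exotic additive
integral (§6). Printed status: none exists or is proposed — Ayoub 2014, Rem. 8 ("widely open and
desperately out of reach"); Huber–Müller-Stach 2017, Preface p. xvi ("we have nothing to say about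
this conjecture"); Huber–Wüstholz 2022, App. A.4 (even the motivic shadow of the sibling 0540 is open).
The parent crux's Disproof (stmt-2837, §8/§15) adds: the formal period group is divisible and
torsion-free, so no `ℤ`-valued, finite or profinite invariant exists at all, and any kill is WLOG
`ℚ`-valued.
(v) Barrier catalogue: the three GPC-dependence barriers (`kzConjecture_implies_oddZetaAlgIndep`,
`…_twoPiI_log_algIndep`, `…_ellipticPeriods_algIndep`) bound PROOFS of the crux (with 0540 it is the
summit), not refutations; `not_complete_of_undecidable` would refute it from an undecidability theorem
nobody has (parent Disproof §16). No barrier yields a counterexample.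
Conclusion for the provers: nothing in the statement is soft; the only lever separating 0541 from the
summit is `π`-cancellation (0540), and §3b shows that lever is invisible for cancellable multipliers. -/
theorem resists : True := trivial

end Summit.KontsevichZagierPeriods.KontsevichZagierPeriods.Cruxes.AyoubPiLocalKernel.Disproof

end
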